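import Summits.QuantumFields.BalabanUV.Beta.GAN24.WSlotT2TablesAn1
import Summits.QuantumFields.BalabanUV.Gaps.CapTailLimitNecessary
import Summits.QuantumFields.BalabanUV.Gaps.CapSignsNecessaryFwd

/-!
# Gaps / CapTailEndNecessity — END GRADE FORCES A NONNEGATIVE LIMIT: `EndpointExistence` + convergent one-loop coefficients ⟹ `0 ≤ β⁰_∞`
# (forward generation, `EverySlope`, (U) only), and at the pinned literal `JsBalAn1` END grade ⟹ `0 ≤ lim_j β⁰_j`; v2 (APPEND-ONLY) §4: the
# CONVERGENCE-FREE form — END grade ⟹ no negative linear drift of the partial sums of β⁰, (U)-free; §5: its SHARPNESS in coefficient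
# currency (harmonic witness; g1-plan-2 GEN 16's X-87 companion probe ADOPTED with attribution); v2.2 (APPEND-ONLY) §6: the WINDOWED
# form «bounded drawdown of β⁰ + r» (every window, prompted by g1-plan-2's S-32) (cell pub-balaban-gaps, seat g1-p3
# gen 5, CAP+tail «split ∕ weakening» charge; necessity twin of `CapTailPinnedLimitSign.endpointExistence_of_pinned_limPos` (END ⟸ `0 < lim`))

HONEST FRAMING (cell rule, page 1 of everything): bookkeeping over hypothesis SHAPES and typed objects of the tree's β sub-cell; NOTHING of
Bałaban's is asserted beyond print; `EndpointExistence` is the cell's END-grade statement (a tuned bare coupling for every cutoff), not a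
printed theorem — here it is a HYPOTHESIS; convergence of `β⁰` ∕ the sign of its limit are located UNPRINTED inputs (rows tail ∕ (D1)); (D4) enters as
`EverySlope`, (U) as `BetaUpperH`; for the pinned literal the convergence is the tree's hypothesis-free all-scales rate (gan24-p1) and the dictionary
`hβ` is the reading clause (W-KKT-2) as a binder; 0 coefficients certified; 0∕6 binders discharged; one finite T⁴; NOT `BetaPertH`, NOT the
continuum limit, NOT Clay.  HONEST DEPENDENCY (b2b cell, verbatim): «continuum YM on T⁴ ⇐ BetaPertH ∧ nine spine estimates (0/9 proved);
BetaPertH ⇐ (D1) ∧ (D4) ∧ CAP+tail; G-an2-4 gates asym, D1 and NE2/3/4.»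

THE POINT ([folklore]).  Along a run of a forward-generated construction that stays in `]0,γ]`, `1∕g_0² − 1∕g_K² ≤ Σ_{j<K} β_j(g_0,…,g_j)` (gen 3's
`CapSignsNecessaryFwd.windowSum_ge_of_forwardGenerated`, g1-plan-2 X-43).  If `β⁰_j → β⁰_∞ < 0`, then on a small enough box (`EverySlope` with slope
`|β⁰_∞|∕4`) `β_j ≤ β⁰_∞∕4 < 0` for `j ≥ k₁`, while `β_j ≤ β′` always ((U)); so `1∕g_0² < 1∕g_K² + k₁·max(β′,0) + (K − k₁)·β⁰_∞∕4`, which is NEGATIVE for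
`K` large at fixed `g_K = g` — no tuned bare coupling exists: `¬ EndpointExistence`.  Hence **`binf_nonneg_of_endpointExistence`**: END grade +
convergence ⟹ `0 ≤ β⁰_∞`; and at the pinned literal (hypothesis-free convergence) **`limNonneg_of_endpointExistence_pinned`**.  With
`CapTailPinnedLimitSign.endpointExistence_of_pinned_limPos` (END ⟸ `0 < lim`): at the pinned literal the tail's END-grade content is the SIGN of
the limit up to the boundary `lim = 0` (which is genuinely remainder-decided: gen 3's `CapFloorNotNecessary.boundary_decided_by_remainder`).
RELEVANCE: `EndpointExistence D.C.toB12` is the β-binder `hEnd` of the print-faithful headline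
`T4ContinuumYM4Torus.continuumYM4_torus_of_endpointExistence` (binders `hD` (B1), `hB` (B), `hEnd`, `hNE` (NE7-slot); plan-2 N-c); so for constructions whose one-loop coefficients are the
pinned literal's (dictionary `hβ`), the headline's β-binder FORCES `0 ≤ lim β⁰_j` and is SUPPLIED by `0 < lim β⁰_j` (+ (D4)∕(U)∕(L)∕(C)).
0 sorry; 0 def; imports tree files only; restates nothing.

CITATION HEADER (tags CONTEXT ONLY).  [I] = T. Bałaban, Commun. Math. Phys. **109** (1987) [Balaban1987RG1]: Thm 2 p. 259 (first sentence: the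
existence of `g₀(ε, g)`), (0.17)–(0.20) pp. 255–256, (1.22) p. 264.
-/

namespace Summit.QuantumFields.BalabanUV.Gaps.CapTailEndNecessity

open Literature.MathematicalPhysics.QuantumFieldTheory.Balaban1983to89
open Literature.MathematicalPhysics.QuantumFieldTheory.Balaban1983to89.FlowStep
open Literature.MathematicalPhysics.QuantumFieldTheory.Balaban1983to89.FlowStepRuns
open Literature.MathematicalPhysics.QuantumFieldTheory.Balaban1983to89.DagBinding
open Literature.MathematicalPhysics.QuantumFieldTheory.Balaban1983to89.Beta
open Literature.MathematicalPhysics.QuantumFieldTheory.Balaban1983to89.Beta.RateCertificate (CauchyRate)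
open Literature.MathematicalPhysics.QuantumFieldTheory.Balaban1983to89.Beta.RemainderChain (RemainderConst)
open Literature.MathematicalPhysics.QuantumFieldTheory.Balaban1983to89.Beta.OneStepKernelFamily (TbalOf)
open Literature.MathematicalPhysics.QuantumFieldTheory.Balaban1983to89.Beta.AffineAveraging (box)
open Summit.QuantumFields.BalabanUV.Gaps.CapSignsConstRoad (EverySlope)
open Summit.QuantumFields.BalabanUV.Gaps.CapSignsNecessaryFwd (windowSum_ge_of_forwardGenerated)
open Summit.QuantumFields.BalabanUV.Beta.MixedJetTablesPlug (JsBalAn1)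
open Summit.QuantumFields.BalabanUV.Beta.GAN24.WSlotT2TablesAn1 (allScalesSeq_secondMoment_JsBalAn1_pinned)
open Summit.QuantumFields.BalabanUV.Beta.GAN24.StencilSlotOfE3 (one_le_of_two_le)
open Filter Topology Finset

noncomputable section

variable {β : HBeta}

/-! ## §1 A ceiling on the β-functions along small histories, from a ceiling on β⁰ and the constant-form remainder -/

/-- On a history in `]0,γ]^{j+1}` the split and `RemainderConst S γ s` give `β_j(p) ≤ β⁰_{j+1} + s`. [folklore] -/
theorem beta_le_beta0_add {S : B12Beta.OneLoopSplit β} {γ s : ℝ} (hR : RemainderConst S γ s) (j : ℕ) {p : Fin (j + 1) → ℝ}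
    (hp : p ∈ Box γ j) : β j p ≤ S.β0 j + s := by
  have h1 := (abs_le.mp (hR j p fun i => (mem_box.mp hp i))).2
  rw [S.split j p]
  linarith

/-! ## §2 END grade forces a nonnegative limit -/

/-- **END GRADE ⟹ `0 ≤ β⁰_∞`** (forward generation, `EverySlope S γc`, (U) `BetaUpperH β′ γc β`, convergence `β⁰_j → β⁰_∞`): if `β⁰_∞ < 0` the
forward-generated runs cannot be tuned to a fixed `g_K = g` for large `K` — the realised window inequality `1∕g_0² − 1∕g_K² ≤ Σ_{j<K} β_j` and the
eventual ceiling `β_j ≤ β⁰_∞∕4 < 0` on a small box make `1∕g_0²` negative.  So `EndpointExistence C` forces `0 ≤ β⁰_∞`.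
[cite: Balaban1987RG1, Thm 2 p.259 (first sentence) and (0.17)–(0.20) pp.255–256] -/
theorem binf_nonneg_of_endpointExistence {C : B12.Construction} (hgen : ForwardGenerated C β) (S : B12Beta.OneLoopSplit β)
    {γc β' binf : ℝ} (hrem : EverySlope S γc) (hup : BetaUpperH β' γc β) (hlim : Tendsto S.β0 atTop (𝓝 binf))
    (hE : EndpointExistence C) : 0 ≤ binf := by
  refine le_of_not_gt fun hneg => ?_
  -- remainder small on a box ]0,γ] ⊆ ]0,γc]
  obtain ⟨γ, hγ, hγle, hR⟩ := hrem (-binf / 4) (by linarith)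
  -- eventual ceiling on β⁰
  obtain ⟨k₁, hk₁⟩ := eventually_atTop.mp (hlim.eventually (Iio_mem_nhds (show binf < binf / 2 by linarith)))
  -- END at torus exponent 0
  obtain ⟨γ₂, hγ₂, hγ₂run⟩ := hE 0
  obtain ⟨gstar, hgstar, hg⟩ := hγ₂run (min γ γ₂) (lt_min hγ hγ₂) (min_le_right _ _)
  have hrun := hg gstar hgstar le_rfl
  -- choose K large
  set B : ℝ := max β' 0 with hB
  have hB0 : 0 ≤ B := le_max_right _ _
  have hq : 0 < -binf / 4 := by linarith
  obtain ⟨N, hN⟩ := exists_nat_gt (((k₁ : ℝ) * B + 1 / gstar ^ 2) / (-binf / 4))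
  have hN' : (k₁ : ℝ) * B + 1 / gstar ^ 2 < (N : ℝ) * (-binf / 4) := by rwa [div_lt_iff₀ hq] at hN
  obtain ⟨g0, hI, hend⟩ := hrun (k₁ + N)
  set P : B12.RunParams := ⟨k₁ + N, 0, g0⟩ with hP
  -- realised window inequality on [0, k₁+N)
  have hw := windowSum_ge_of_forwardGenerated hgen P hI (Nat.zero_le (k₁ + N)) le_rfl
  -- termwise ceilings
  have hbox : ∀ j, j ≤ k₁ + N → prefixOf (C P).flow.g j ∈ Box (min γ γ₂) j := fun j hj =>
    mem_box.mpr fun i => hI i (le_trans (by have := i.isLt; omega) hj)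
  have hearly : ∀ j ∈ Ico 0 k₁, β j (prefixOf (C P).flow.g j) ≤ B := fun j hj => by
    have hjK : j ≤ k₁ + N := by have := (mem_Ico.mp hj).2; omega
    exact (hup j _ (box_mono ((min_le_left _ _).trans hγle) j (hbox j hjK))).trans (le_max_left _ _)
  have hlate : ∀ j ∈ Ico k₁ (k₁ + N), β j (prefixOf (C P).flow.g j) ≤ binf / 4 := fun j hj => by
    have hjK : j ≤ k₁ + N := (mem_Ico.mp hj).2.le
    have h1 := beta_le_beta0_add hR j (box_mono (min_le_left _ _) j (hbox j hjK))
    have h2 : S.β0 j < binf / 2 := hk₁ j (mem_Ico.mp hj).1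
    linarith
  have hsplit : ∑ j ∈ Ico 0 (k₁ + N), β j (prefixOf (C P).flow.g j) =
      ∑ j ∈ Ico 0 k₁, β j (prefixOf (C P).flow.g j) + ∑ j ∈ Ico k₁ (k₁ + N), β j (prefixOf (C P).flow.g j) :=
    (sum_Ico_consecutive _ (Nat.zero_le k₁) (Nat.le_add_right k₁ N)).symm
  have hS1 : ∑ j ∈ Ico 0 k₁, β j (prefixOf (C P).flow.g j) ≤ (k₁ : ℝ) * B := by
    have := sum_le_sum hearly
    rw [sum_const, Nat.card_Ico, nsmul_eq_mul, Nat.sub_zero] at this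
    exact this
  have hS2 : ∑ j ∈ Ico k₁ (k₁ + N), β j (prefixOf (C P).flow.g j) ≤ (N : ℝ) * (binf / 4) := by
    have := sum_le_sum hlate
    rw [sum_const, Nat.card_Ico, nsmul_eq_mul, add_tsub_cancel_left] at this
    exact this
  -- the left end: 1/g_0² > 0, 1/g_K² = 1/gstar²
  have hg0 : 0 < (C P).flow.g 0 := (hI 0 (Nat.zero_le _)).1
  have h0 : 0 < 1 / ((C P).flow.g 0) ^ 2 := by positivity
  have hK : (C P).flow.g (k₁ + N) = gstar := hend
  rw [hK, hsplit] at hw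
  linarith

/-- The same with convergence stated through `CauchyRate.lim` for a `CauchyRate` sequence (`θ < 1`). [folklore] -/
theorem lim_nonneg_of_endpointExistence {C : B12.Construction} (hgen : ForwardGenerated C β) (S : B12Beta.OneLoopSplit β)
    {γc β' c θ : ℝ} (hrem : EverySlope S γc) (hup : BetaUpperH β' γc β) (hrate : CauchyRate S.β0 c θ) (hθ1 : θ < 1)
    (hE : EndpointExistence C) : 0 ≤ CauchyRate.lim S.β0 :=
  binf_nonneg_of_endpointExistence hgen S hrem hup (hrate.tendsto_lim hθ1) hE

/-! ## §3 At the pinned literal: END grade ⟹ `0 ≤ lim β⁰_j` -/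

/-- **AT THE PINNED LITERAL `JsBalAn1`, END GRADE FORCES `0 ≤ lim β⁰_j`**: a forward-generated construction whose split carries the literal's
one-loop coefficients (`hβ`), with `EverySlope` and (U): `EndpointExistence C → 0 ≤ CauchyRate.lim (j ↦ β⁰_j)` — the convergence being gan24-p1's
hypothesis-free all-scales rate.  With `CapTailPinnedLimitSign.endpointExistence_of_pinned_limPos` (`0 < lim` ⟹ END): the tail's END-grade content at
the literal is the sign of the limit, up to the boundary `lim = 0`. [cite: Balaban1987RG1, Thm 2 p.259 (first sentence) and (1.22) p.264] -/
theorem limNonneg_of_endpointExistence_pinned {Lc : ℕ} [NeZero Lc] (hLc : 2 ≤ Lc) {r : Fin (3 + 1) → ℕ} (hr : r ∈ box (3 + 1) Lc)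
    (cE cVH cΛ cB : ℝ) (Tc : Fin 4 → Fin 4 → Fin 4 → Fin 4 → ℝ) (μ ν : Fin 4) {C : B12.Construction} (hgen : ForwardGenerated C β)
    (S : B12Beta.OneLoopSplit β)
    (hβ : ∀ j, S.β0 j = B12Beta.secondMoment
        (TbalOf Lc (JsBalAn1 (one_le_of_two_le hLc) hr cE cVH cΛ ((Lc : ℝ) ^ (2 * (3 + 1))) cB Tc) j) μ ν)
    {γc β' : ℝ} (hrem : EverySlope S γc) (hup : BetaUpperH β' γc β) (hE : EndpointExistence C) :
    0 ≤ CauchyRate.lim (fun j => B12Beta.secondMoment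
        (TbalOf Lc (JsBalAn1 (one_le_of_two_le hLc) hr cE cVH cΛ ((Lc : ℝ) ^ (2 * (3 + 1))) cB Tc) j) μ ν) := by
  obtain ⟨κ, θ, -, hθ1, hall⟩ := allScalesSeq_secondMoment_JsBalAn1_pinned hLc hr cE cVH cΛ cB Tc μ ν
  have hS : S.β0 = fun j => B12Beta.secondMoment
      (TbalOf Lc (JsBalAn1 (one_le_of_two_le hLc) hr cE cVH cΛ ((Lc : ℝ) ^ (2 * (3 + 1))) cB Tc) j) μ ν := funext hβ
  have h := lim_nonneg_of_endpointExistence hgen S hrem hup (hS ▸ hall.cauchyRate) hθ1 hE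
  rwa [hS] at h

/-! ## §4 (v2, APPEND-ONLY) The convergence-free form: END grade forbids any negative linear drift of the partial sums of β⁰ -/

/-- **END GRADE ⟹ THE PARTIAL SUMS OF `β⁰ + r` ARE BOUNDED BELOW** (forward generation; the constant-form remainder `RemainderConst S γ r` on ONE box;
NO upper bound (U), NO convergence, NO rate): `EndpointExistence C` ⟹ `∃ D, ∀ K, −D ≤ Σ_{j<K} (β⁰_{j+1} + r)`.  Proof: tune a run to `g_K = g⋆` inside
`]0, min γ γ₂]`; the realised window inequality gives `0 < 1∕g_0² ≤ 1∕g⋆² + Σ_{j<K} β_j(g_0,…,g_j) ≤ 1∕g⋆² + Σ_{j<K} (β⁰_{j+1} + r)`; take `D = 1∕g⋆²`.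
This is the END-grade twin of gen 3's Theorem-2-grade (N2) (`CapSignsNecessary.beta0_windowSum_lower_of_thm2Printed`: slope `c > 0`); here the
slope is `−r`, as small as the remainder box allows. [cite: Balaban1987RG1, Thm 2 p.259 (first sentence) and (0.17)–(0.20) pp.255–256] -/
theorem partialSum_lower_of_endpointExistence {C : B12.Construction} (hgen : ForwardGenerated C β) (S : B12Beta.OneLoopSplit β)
    {γ r : ℝ} (hγ : 0 < γ) (hR : RemainderConst S γ r) (hE : EndpointExistence C) :
    ∃ D : ℝ, ∀ K : ℕ, -D ≤ ∑ j ∈ range K, (S.β0 j + r) := by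
  obtain ⟨γ₂, hγ₂, hγ₂run⟩ := hE 0
  obtain ⟨gstar, hgstar, hg⟩ := hγ₂run (min γ γ₂) (lt_min hγ hγ₂) (min_le_right _ _)
  have hrun := hg gstar hgstar le_rfl
  refine ⟨1 / gstar ^ 2, fun K => ?_⟩
  obtain ⟨g0, hI, hend⟩ := hrun K
  set P : B12.RunParams := ⟨K, 0, g0⟩ with hP
  have hw := windowSum_ge_of_forwardGenerated hgen P hI (Nat.zero_le K) le_rfl
  have hbox : ∀ j, j ≤ K → prefixOf (C P).flow.g j ∈ Box (min γ γ₂) j := fun j hj =>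
    mem_box.mpr fun i => hI i (le_trans (by have := i.isLt; omega) hj)
  have hterm : ∀ j ∈ Ico 0 K, β j (prefixOf (C P).flow.g j) ≤ S.β0 j + r := fun j hj =>
    beta_le_beta0_add hR j (box_mono (min_le_left _ _) j (hbox j (mem_Ico.mp hj).2.le))
  have hsum := sum_le_sum hterm
  rw [← Finset.range_eq_Ico] at hsum
  have hg0 : 0 < (C P).flow.g 0 := (hI 0 (Nat.zero_le _)).1
  have h0 : 0 < 1 / ((C P).flow.g 0) ^ 2 := by positivity
  have hK : (C P).flow.g K = gstar := hend
  rw [hK, ← Finset.range_eq_Ico] at hw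
  linarith

/-- **END GRADE ⟹ NO NEGATIVE LINEAR DRIFT OF THE PARTIAL SUMS** (forward generation + `EverySlope S γc`; no (U), no convergence): for every slope
`s > 0` there is `D` with `−s·K − D ≤ Σ_{j<K} β⁰_{j+1}` for all `K` — the Cesàro means of `β⁰` have nonnegative `liminf`.  The END-grade twin of
(N2). [cite: Balaban1987RG1, Thm 2 p.259 (first sentence)] -/
theorem partialSum_noNegDrift_of_endpointExistence {C : B12.Construction} (hgen : ForwardGenerated C β) (S : B12Beta.OneLoopSplit β)
    {γc : ℝ} (hrem : EverySlope S γc) (hE : EndpointExistence C) {s : ℝ} (hs : 0 < s) :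
    ∃ D : ℝ, ∀ K : ℕ, -s * K - D ≤ ∑ j ∈ range K, S.β0 j := by
  obtain ⟨γ, hγ, -, hR⟩ := hrem s hs
  obtain ⟨D, hD⟩ := partialSum_lower_of_endpointExistence hgen S hγ hR hE
  refine ⟨D, fun K => ?_⟩
  have h := hD K
  rw [sum_add_distrib, sum_const, card_range, nsmul_eq_mul] at h
  linarith

/-- §2 as a COROLLARY of §4 (the convergent case): if moreover `β⁰_j → β⁰_∞`, then `0 ≤ β⁰_∞` — with `s := −β⁰_∞∕4` the partial sums would drift
like `(β⁰_∞∕2)·K` eventually, below `−s·K − D`.  ((U) is NOT needed in this road; §2's direct proof used it only to bound the early terms.)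
[cite: Balaban1987RG1, Thm 2 p.259 (first sentence)] -/
theorem binf_nonneg_of_endpointExistence' {C : B12.Construction} (hgen : ForwardGenerated C β) (S : B12Beta.OneLoopSplit β)
    {γc binf : ℝ} (hrem : EverySlope S γc) (hlim : Tendsto S.β0 atTop (𝓝 binf)) (hE : EndpointExistence C) : 0 ≤ binf := by
  refine le_of_not_gt fun hneg => ?_
  obtain ⟨D, hD⟩ := partialSum_noNegDrift_of_endpointExistence hgen S hrem hE (show 0 < -binf / 4 by linarith)
  obtain ⟨k₁, hk₁⟩ := eventually_atTop.mp (hlim.eventually (Iio_mem_nhds (show binf < binf / 2 by linarith)))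
  -- partial sums: Σ_{j<k₁+N} β⁰ ≤ Σ_{j<k₁} β⁰ + N·(binf/2)
  have hdecomp : ∀ N : ℕ, ∑ j ∈ range (k₁ + N), S.β0 j ≤ ∑ j ∈ range k₁, S.β0 j + N * (binf / 2) := by
    intro N
    induction N with
    | zero => simp
    | succ N ih =>
        rw [show k₁ + (N + 1) = (k₁ + N) + 1 by ring, sum_range_succ, Nat.cast_succ]
        have := hk₁ (k₁ + N) (Nat.le_add_right _ _)
        linarith
  -- choose N with N·(−binf/4) > Σ_{j<k₁} β⁰ + D + s·k₁-type slack
  obtain ⟨N, hN⟩ := exists_nat_gt ((∑ j ∈ range k₁, S.β0 j + D + (-binf / 4) * k₁) / (-binf / 4))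
  have hq : 0 < -binf / 4 := by linarith
  rw [div_lt_iff₀ hq] at hN
  have h1 := hD (k₁ + N)
  have h2 := hdecomp N
  push_cast at h1
  nlinarith

/-! ## §5 (v2) SHARPNESS of §4 in coefficient currency: «no negative linear drift» does NOT give «partial sums bounded below»
(ADOPTED, with attribution, from g1-plan-2 GEN 16's companion probe `g1/skeletons/XreadCesaroWindow_plan2.lean` 54a5fbd6b48d47a2 to XREAD X-87;
restated here WITHOUT `def`s, on the explicit harmonic witness `j ↦ −1∕(j+1)`; [folklore] real analysis) -/

/-- (PS) in coefficient currency ⟹ no negative linear drift (the easy direction). [folklore] -/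
theorem noNegDrift_of_partialSumsLower {b : ℕ → ℝ} (h : ∃ D : ℝ, ∀ K : ℕ, -D ≤ ∑ j ∈ range K, b j) :
    ∀ s : ℝ, 0 < s → ∃ D : ℝ, ∀ K : ℕ, -s * K - D ≤ ∑ j ∈ range K, b j := by
  obtain ⟨D, hD⟩ := h
  intro s hs
  refine ⟨D, fun K => ?_⟩
  have h1 := hD K
  have h2 : (0 : ℝ) ≤ s * K := by positivity
  linarith

/-- Termwise bound behind the harmonic witness: `1∕(j+1) ≤ 𝟙[j < ⌈1∕s⌉₊] + s` (`s > 0`). [folklore] -/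
theorem one_div_succ_le_indicator_add (s : ℝ) (hs : 0 < s) (j : ℕ) :
    1 / ((j : ℝ) + 1) ≤ (if j < ⌈1 / s⌉₊ then (1 : ℝ) else 0) + s := by
  have hj : (0 : ℝ) < (j : ℝ) + 1 := by positivity
  by_cases h : j < ⌈1 / s⌉₊
  · rw [if_pos h]
    have : 1 / ((j : ℝ) + 1) ≤ 1 := by
      rw [div_le_one hj]
      have : (0 : ℝ) ≤ j := by positivity
      linarith
    linarith
  · rw [if_neg h]
    have h' : ⌈1 / s⌉₊ ≤ j := not_lt.mp h
    have hN : (1 / s : ℝ) ≤ (⌈1 / s⌉₊ : ℝ) := Nat.le_ceil _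
    have hjN : (⌈1 / s⌉₊ : ℝ) ≤ (j : ℝ) := by exact_mod_cast h'
    have h1 : 1 / s < (j : ℝ) + 1 := by linarith
    have h2 : 1 / ((j : ℝ) + 1) < s := by
      rw [div_lt_iff₀ hj]
      have := (div_lt_iff₀ hs).mp h1
      linarith
    linarith

/-- The harmonic partial sums grow at most like `⌈1∕s⌉₊ + s·K`, for every `s > 0`. [folklore] -/
theorem harmonic_sum_le (s : ℝ) (hs : 0 < s) (K : ℕ) :
    ∑ j ∈ range K, 1 / ((j : ℝ) + 1) ≤ (⌈1 / s⌉₊ : ℝ) + s * K := by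
  calc ∑ j ∈ range K, 1 / ((j : ℝ) + 1)
      ≤ ∑ j ∈ range K, ((if j < ⌈1 / s⌉₊ then (1 : ℝ) else 0) + s) :=
        sum_le_sum fun j _ => one_div_succ_le_indicator_add s hs j
    _ = (∑ j ∈ range K, (if j < ⌈1 / s⌉₊ then (1 : ℝ) else 0)) + s * K := by
        rw [sum_add_distrib, sum_const, card_range, nsmul_eq_mul, mul_comm]
    _ ≤ (⌈1 / s⌉₊ : ℝ) + s * K := by
        gcongr
        rw [← Finset.sum_filter, sum_const, nsmul_eq_mul, mul_one]
        have : ((range K).filter (fun j => j < ⌈1 / s⌉₊)).card ≤ ⌈1 / s⌉₊ := by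
          calc ((range K).filter (fun j => j < ⌈1 / s⌉₊)).card
              ≤ (range ⌈1 / s⌉₊).card := by
                apply card_le_card
                intro j hj
                simp only [mem_filter, mem_range] at hj ⊢
                exact hj.2
            _ = ⌈1 / s⌉₊ := card_range _
        exact_mod_cast this

/-- **THE HARMONIC WITNESS HAS NO NEGATIVE LINEAR DRIFT**: `b_j = −1∕(j+1)` satisfies the conclusion SHAPE of §4's
`partialSum_noNegDrift_of_endpointExistence`. [folklore] -/
theorem harmonic_noNegDrift : ∀ s : ℝ, 0 < s → ∃ D : ℝ, ∀ K : ℕ,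
    -s * K - D ≤ ∑ j ∈ range K, (-(1 / ((j : ℝ) + 1))) := by
  intro s hs
  refine ⟨(⌈1 / s⌉₊ : ℝ), fun K => ?_⟩
  have h := harmonic_sum_le s hs K
  rw [sum_neg_distrib]
  linarith

/-- **… YET ITS PARTIAL SUMS ARE NOT BOUNDED BELOW** (divergence of the harmonic series, Mathlib's
`Real.tendsto_sum_range_one_div_nat_succ_atTop`). [folklore] -/
theorem harmonic_not_partialSumsLower : ¬ ∃ D : ℝ, ∀ K : ℕ, -D ≤ ∑ j ∈ range K, (-(1 / ((j : ℝ) + 1))) := by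
  rintro ⟨D, hD⟩
  have h := Real.tendsto_sum_range_one_div_nat_succ_atTop
  obtain ⟨K, hK⟩ := (h.eventually (eventually_gt_atTop D)).exists
  have := hD K
  rw [sum_neg_distrib] at this
  linarith

/-- **THE TWO CURRENCIES SEPARATE**: «no negative linear drift» (§4, END-grade necessity in coefficient currency) does NOT imply «partial sums
bounded below» ((PS), the sufficiency side's currency — `WeakestBetaCurrency`, `Beta.Drift.betaPartialSumsLowerH_of_drift`).  So the SUBLINEAR
window (Cesàro `liminf ≥ 0` but partial sums `→ −∞`) is genuinely undecided at END grade by §4, together with the boundary `lim = 0` (g1-plan-2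
X-87 (iii)). [folklore] -/
theorem noNegDrift_not_imp_partialSumsLower :
    ¬ ∀ b : ℕ → ℝ, (∀ s : ℝ, 0 < s → ∃ D : ℝ, ∀ K : ℕ, -s * K - D ≤ ∑ j ∈ range K, b j) →
      ∃ D : ℝ, ∀ K : ℕ, -D ≤ ∑ j ∈ range K, b j := fun h =>
  harmonic_not_partialSumsLower (h _ harmonic_noNegDrift)

/-- **WHAT WOULD CLOSE THE WINDOW FROM THE NECESSITY SIDE, IN KIND**: a per-step slack that is SUMMABLE along the run upgrades the shape of §4's
`partialSum_lower_of_endpointExistence` (there with a CONSTANT slack `r` per box) to (PS) for `β⁰` itself.  A constant positive slack is exactly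
what the harmonic witness survives. [folklore] -/
theorem partialSumsLower_of_summable_slack {b r : ℕ → ℝ} (hr : ∀ j, 0 ≤ r j) (hs : Summable r) {D : ℝ}
    (h : ∀ K : ℕ, -D ≤ ∑ j ∈ range K, (b j + r j)) : ∃ D' : ℝ, ∀ K : ℕ, -D' ≤ ∑ j ∈ range K, b j := by
  refine ⟨D + ∑' j, r j, fun K => ?_⟩
  have h1 := h K
  have h2 : ∑ j ∈ range K, r j ≤ ∑' j, r j := hs.sum_le_tsum (range K) (fun j _ => hr j)
  rw [sum_add_distrib] at h1
  linarith

/-! ## §6 (v2.2, APPEND-ONLY) The WINDOWED form: END grade bounds EVERY window sum of `β⁰ + r` from below («bounded drawdown»)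
(prompted by g1-plan-2 GEN 16's S-32 «bounded drawdown» criterion in the pure one-loop caricature, `XreadEndWindowModel_plan2.lean` §8∕§11 —
there: pure one-loop END ⟺ bounded drawdown = the tree's windowed (PS) shape `FlowStepRuns.BetaPartialSumsLowerH`; here: the necessity half WITH
a constant-form remainder, for every forward-generated construction) -/

/-- **END GRADE ⟹ BOUNDED DRAWDOWN OF `β⁰ + r`** (forward generation; `RemainderConst S γ r` on ONE box; no (U), no convergence): `EndpointExistence C`
⟹ `∃ D, ∀ k ≤ K, −D ≤ Σ_{j∈[k,K)} (β⁰_{j+1} + r)` with `D = 1∕g⋆²` — EVERY window, not only those starting at `0` (§4): along the tuned run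
`0 < 1∕g_k²` and `1∕g_k² − 1∕g_K² ≤ Σ_{[k,K)} β_j ≤ Σ_{[k,K)} (β⁰_{j+1} + r)` (gen 3's realised window inequality at a general left end).  In the pure
one-loop caricature (`r = 0`) this is the necessity half of g1-plan-2's S-32 criterion «END ⟺ bounded drawdown».
[cite: Balaban1987RG1, Thm 2 p.259 (first sentence) and (0.17)–(0.20) pp.255–256] -/
theorem windowSum_lower_of_endpointExistence {C : B12.Construction} (hgen : ForwardGenerated C β) (S : B12Beta.OneLoopSplit β)
    {γ r : ℝ} (hγ : 0 < γ) (hR : RemainderConst S γ r) (hE : EndpointExistence C) :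
    ∃ D : ℝ, ∀ k K : ℕ, k ≤ K → -D ≤ ∑ j ∈ Ico k K, (S.β0 j + r) := by
  obtain ⟨γ₂, hγ₂, hγ₂run⟩ := hE 0
  obtain ⟨gstar, hgstar, hg⟩ := hγ₂run (min γ γ₂) (lt_min hγ hγ₂) (min_le_right _ _)
  have hrun := hg gstar hgstar le_rfl
  refine ⟨1 / gstar ^ 2, fun k K hkK => ?_⟩
  obtain ⟨g0, hI, hend⟩ := hrun K
  set P : B12.RunParams := ⟨K, 0, g0⟩ with hP
  have hw := windowSum_ge_of_forwardGenerated hgen P hI hkK le_rfl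
  have hbox : ∀ j, j ≤ K → prefixOf (C P).flow.g j ∈ Box (min γ γ₂) j := fun j hj =>
    mem_box.mpr fun i => hI i (le_trans (by have := i.isLt; omega) hj)
  have hterm : ∀ j ∈ Ico k K, β j (prefixOf (C P).flow.g j) ≤ S.β0 j + r := fun j hj =>
    beta_le_beta0_add hR j (box_mono (min_le_left _ _) j (hbox j (mem_Ico.mp hj).2.le))
  have hsum := sum_le_sum hterm
  have hgk : 0 < (C P).flow.g k := (hI k hkK).1
  have hk0 : 0 < 1 / ((C P).flow.g k) ^ 2 := by positivity
  have hK : (C P).flow.g K = gstar := hend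
  rw [hK] at hw
  linarith

/-- **END GRADE ⟹ NO NEGATIVE LINEAR DRIFT ON ANY WINDOW** (forward generation + `EverySlope S γc`): for every `s > 0` there is `D` with
`−s·(K − k) − D ≤ Σ_{j∈[k,K)} β⁰_{j+1}` for all `k ≤ K`.  The windowed END-grade twin of (N2) (`c·n − A ≤ Σ_{[k,k+n)} β⁰`, `c > 0`, at Theorem-2 grade).
[cite: Balaban1987RG1, Thm 2 p.259 (first sentence)] -/
theorem windowSum_noNegDrift_of_endpointExistence {C : B12.Construction} (hgen : ForwardGenerated C β) (S : B12Beta.OneLoopSplit β)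
    {γc : ℝ} (hrem : EverySlope S γc) (hE : EndpointExistence C) {s : ℝ} (hs : 0 < s) :
    ∃ D : ℝ, ∀ k K : ℕ, k ≤ K → -s * ((K : ℝ) - k) - D ≤ ∑ j ∈ Ico k K, S.β0 j := by
  obtain ⟨γ, hγ, -, hR⟩ := hrem s hs
  obtain ⟨D, hD⟩ := windowSum_lower_of_endpointExistence hgen S hγ hR hE
  refine ⟨D, fun k K hkK => ?_⟩
  have h := hD k K hkK
  rw [sum_add_distrib, sum_const, Nat.card_Ico, nsmul_eq_mul, Nat.cast_sub hkK] at h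
  linarith

end

end Summit.QuantumFields.BalabanUV.Gaps.CapTailEndNecessity
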